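import Summits.Langlands.Langlands.Theorems.SoloInformedAinfDigitNorm
import Literature.NumberTheory.PAdicHodge.BmaxPlusRemainder
import Literature.NumberTheory.PAdicHodge.BmaxPlusFrobeniusImageInter

/-!
# The Frobenius of `A_max = B_max⁺(F)` is injective (solo programme, s78)

An elementary proof of `Function.Injective (frobBmaxPlus F p)` — the input (I1) of the `D_cris` ladder
(`D2Cris.phiDcris_injective_of_frobBmax_injective`) — by the digit calculus on `𝔸_inf(F) = W(𝒪_{ℂ_F}♭)`.
Write `z ∈ A_max` level-wise as `z ≡ Q_n(ξ/p) (mod pⁿ)` with compatible `Q_n ∈ 𝔸_inf[X]`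
(`exists_polynomial_representatives`) and clear denominators: `a_n = p^{D_n} Q_n(ξ/p) ∈ 𝔸_inf` for a monotone
hull `D_n ≥ deg Q_n`.  Then `a_{n+1} ≡ p^{δ_n} a_n (mod 𝔞^{n + D_{n+1}})` with `𝔞 = (p, ξ) = 𝔸_inf ∩ p A_max`, and
`φ(z) = 0` gives `φ(a_n) ∈ 𝔞^{n + D_n}`; the digit engine (`mem_pow_of_frobenius_tower`) forces
`a_n ∈ 𝔞^{n + D_n}`, i.e. `Q_n(ξ/p) ∈ pⁿ A_max`, so every level class of `z` vanishes. [folklore]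
-/

noncomputable section

namespace Summit.Langlands.Langlands.Theorems.AinfDigits

open WittVector NNReal Polynomial Finset
open Literature.NumberTheory.PAdicHodge
open Literature.NumberTheory.GaloisRepresentations
open Literature.NumberTheory.GaloisRepresentations.IsNonarchimedeanLocalField
open Summit.Langlands.Langlands.Theorems.WittDigits

variable {F : Type} [Field F] [ValuativeRel F] [TopologicalSpace F] [IsNonarchimedeanLocalField F] [CharZero F]
  {p : ℕ} [hp : Fact p.Prime] [Fact (¬ IsUnit (p : integerC F))]
  [IsAdicComplete (Ideal.span {(p : integerC F)}) (integerC F)]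

/-- A monotone hull `D ≥ d` together with its increments `δ`: `D (n+1) = D n + δ n`. [folklore] -/
theorem exists_degree_hull (d : ℕ → ℕ) : ∃ D δ : ℕ → ℕ, (∀ n, d n ≤ D n) ∧ ∀ n, D (n + 1) = D n + δ n := by
  let D : ℕ → ℕ := fun n => Nat.rec (d 0) (fun k acc => acc + (d (k + 1) - acc)) n
  refine ⟨D, fun n => d (n + 1) - D n, fun n => ?_, fun n => rfl⟩
  cases n with
  | zero => exact le_rfl
  | succ n =>
    show d (n + 1) ≤ D n + (d (n + 1) - D n)
    exact le_add_tsub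

omit [CharZero F] [IsAdicComplete (Ideal.span {(p : integerC F)}) (integerC F)] in
/-- `φ` on `B⁰_max` extends the Witt-vector Frobenius of `𝔸_inf`. [cite: BergerLaurent2002, §1.2] -/
theorem frobBmaxZero_algebraMap (a : Ainf (p := p) F) :
    frobBmaxZero F p (algebraMap (Ainf (p := p) F) (bmaxZero F p) a) =
      algebraMap (Ainf (p := p) F) (bmaxZero F p) (frobenius a) :=
  Subtype.ext (frobAinfLoc_algebraMap a)

set_option maxHeartbeats 800000 in
/-- ★ **(I1) The Frobenius `φ` of `A_max = B_max⁺(F)` is injective** (for `θ_F` surjective, e.g. `p` a uniformiser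
of `F`): the elementary digit proof described in the module docstring. [cite: Colmez1998Annals, §III.2] -/
theorem frobBmaxPlus_injective (hF : Function.Surjective (fontaineTheta (integerC F) p)) :
    Function.Injective (frobBmaxPlus F p) := by
  refine (injective_iff_map_eq_zero _).2 fun z hz => ?_
  haveI := isDomain_bmaxZero (F := F) (p := p)
  haveI := charZero_bmaxZero (F := F) (p := p)
  obtain ⟨Q, R, hQ, hQR⟩ := exists_polynomial_representatives z
  obtain ⟨D, δ, hdD, hD⟩ := exists_degree_hull fun n => (Q n).natDegree
  -- cleared numerators `a n = p^{D n} Q_n(ξ/p) ∈ 𝔸_inf`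
  obtain ⟨a, ha⟩ : ∃ a : ℕ → Ainf (p := p) F, ∀ n,
      (p : bmaxZero F p) ^ D n * aeval (omegaB : bmaxZero F p) (Q n) = algebraMap (Ainf (p := p) F) (bmaxZero F p) (a n) :=
    ⟨_, fun n => natCast_pow_mul_aeval_omegaB (hdD n)⟩
  -- compatibility along the tower
  have he : ∀ n, a (n + 1) - (p : Ainf (p := p) F) ^ δ n * a n ∈ Ideal.span {(p : Ainf (p := p) F), xi} ^ (n + D (n + 1)) := by
    intro n
    refine mem_span_p_xi_pow_of_algebraMap_mem_pow hF _ ?_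
    have e : algebraMap (Ainf (p := p) F) (bmaxZero F p) (a (n + 1) - (p : Ainf (p := p) F) ^ δ n * a n) =
        (p : bmaxZero F p) ^ (n + D (n + 1)) * aeval (omegaB : bmaxZero F p) (R n) := by
      rw [map_sub, map_mul, map_pow, map_natCast, ← ha, ← ha, hQR n, map_add, map_mul, aeval_C, map_pow, map_natCast, hD n]
      ring
    rw [e, Ideal.span_singleton_pow]
    exact Ideal.mul_mem_right _ _ (Ideal.mem_span_singleton_self _)
  -- `φ(z) = 0` level-wise
  have hφ : ∀ n, frobenius (a n) ∈ Ideal.span {(p : Ainf (p := p) F), xi} ^ (n + D n) := by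
    intro n
    refine mem_span_p_xi_pow_of_algebraMap_mem_pow hF _ ?_
    have h1 : Ideal.Quotient.mk (Ideal.span {(p : bmaxZero F p)} ^ n) (frobBmaxZero F p (aeval (omegaB : bmaxZero F p) (Q n))) = 0 := by
      rw [← evalₐ_frobBmaxPlus_of_eq n (hQ n), hz, map_zero]
    rw [Ideal.Quotient.eq_zero_iff_mem] at h1
    rw [← frobBmaxZero_algebraMap, ← ha, map_mul, map_pow, map_natCast, pow_add, mul_comm ((p : bmaxZero F p) ^ D n)]
    exact Ideal.mul_mem_mul h1 (Ideal.pow_mem_pow (Ideal.mem_span_singleton_self _) _)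
  -- the digit engine: `a n ∈ 𝔞^{n + D n}`, so every level class `Q_n(ξ/p) mod pⁿ` of `z` vanishes
  suffices hlev : ∀ n, aeval (omegaB : bmaxZero F p) (Q n) ∈ Ideal.span {(p : bmaxZero F p)} ^ n from
    AdicCompletion.ext_evalₐ fun n =>
      ((hQ n).trans (Ideal.Quotient.eq_zero_iff_mem.2 (hlev n))).trans (map_zero _).symm
  intro n
  have hmem : a n ∈ Ideal.span {(p : Ainf (p := p) F), xi} ^ (n + D n) := by
    rw [span_p_xi_eq] at he hφ ⊢
    exact mem_pow_of_frobenius_tower (tiltDigitNorm_v_pFlat (F := F) (p := p)) hD he hφ n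
  have h3 := algebraMap_mem_pow_of_mem_span_p_xi_pow hmem
  rw [← ha, Ideal.span_singleton_pow, Ideal.mem_span_singleton] at h3
  obtain ⟨w, hw⟩ := h3
  rw [Ideal.span_singleton_pow, Ideal.mem_span_singleton]
  exact ⟨w, mul_left_cancel₀ (pow_ne_zero (D n) (Nat.cast_ne_zero.2 hp.out.ne_zero)) (by rw [hw, pow_add]; ring)⟩

end Summit.Langlands.Langlands.Theorems.AinfDigits
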